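import Literature.NumberTheory.LFunctions.MontgomeryVaughanLogMeans
import Literature.NumberTheory.LFunctions.HalaszPartialSummation
import Literature.NumberTheory.LFunctions.MellinPlancherel
import Literature.NumberTheory.LFunctions.PerronTruncated
import Literature.NumberTheory.Sieve.BrunTitchmarshShortInterval
import Mathlib.MeasureTheory.Function.JacobianOneDim
import HarnessLib

/-!
# Montgomery–Vaughan 2001, toward Theorem 3: the term `T₁(x) = Σ_{n ≤ x} f(n) log n / n`

Support file (everything PROVED, no definitions, no named facts) for the discharge of
`Literature.NumberTheory.LFunctions.MontgomeryVaughan2001_thm3` (H. L. Montgomery, R. C. Vaughan,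
*Mean values of multiplicative functions*, Period. Math. Hungar. 43 (2001), Theorem 3), following
the self-contained reproduction of the proof of MV Theorem 2 in Roy–Vatwani 2019, §6.1 at `k = 1`.

For `f : ℕ →*₀ ℂ` totally multiplicative with `|f| ≤ 1`, `S₁(u) = Σ_{n ≤ u} f(n)/n`, and
`T₁(v) = Σ_{n ≤ v} f(n) log n/n`:

* `T₁(v) = Σ_{d ≤ v} (f(d)Λ(d)/d) S₁(v/d)` (the tree's `Halasz.sum_mul_log_eq` for the completely
  multiplicative `f(n)/n`), so `|T₁(v)| ≤ Σ_{d ≤ x} (Λ(d)/d)|S₁(v/d)|` for `v ≤ x`;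
* smoothing over `x − h ≤ v ≤ x`, `h = x/log x` (`|T₁(x) − T₁(v)| ≤ 3`), the substitution `u = v/d`
  and the interchange of `Σ_d` and `∫ du` (Roy–Vatwani (eq:bdT1)–(eq:int2));
* the short-interval bound `ψ(X) − ψ(X − X/log x) ≪ X/log x` for `X ≥ log⁵ x` (the tree's
  Brun–Titchmarsh theorem `Sieve.sum_log_primes_Ioc_le` for the primes, Chebyshev's
  `ψ − ϑ ≤ 2√X log X` (Mathlib) for the prime powers; Roy–Vatwani use Montgomery–Vaughan 1973,
  Theorem 2), and `Σ_{d ≤ D} Λ(d)/d ≤ e(log D + K₀)` for the `d ≤ log⁵ x`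
  (from the tree's `−ζ'/ζ(σ) ≤ 1/(σ−1) + K₀`).

Result (`exists_norm_T₁_le`): for `x ≥ e^{40}` and any `M` with `|S₁(u)| log u ≤ M` (`1 ≤ u ≤ x`),

`|T₁(x)| ≤ 3 + K ∫_0^{log x} |S₁(e^w)| dw + K (log log x/log x) M`

with an absolute `K` — Roy–Vatwani's (eq:bound T1), `T₁(x) ≪ ∫_1^x |S₁(u)| du/u + |S₁(x)| log log x`,
in the form consumed by the proof of Theorem 3.

## References
- [MontgomeryVaughan2001] H. L. Montgomery, R. C. Vaughan, *Mean values of multiplicative functions*,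
  Period. Math. Hungar. 43 (2001), §3, proof of Theorem 2 (not held; read through:)
- [RoyVatwani2019] A. Roy, A. Vatwani, *Zeros of partial sums of L-functions*, arXiv:1807.11093, §6.1,
  (eq:identity for f)–(eq:bound T1) (arXiv pp. 13–14).
- [MontgomeryVaughanMathematika1973] H. L. Montgomery, R. C. Vaughan, *The large sieve*, Mathematika 20 (1973),
  Theorem 2 (Brun–Titchmarsh; here any absolute constant suffices).
-/

noncomputable section

open Complex Real MeasureTheory Set Filter Finset intervalIntegral
open scoped ArithmeticFunction.vonMangoldt Chebyshev

namespace Literature.NumberTheory.LFunctions.MontgomeryVaughan2001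

open MellinPlancherel (psum)

/-! ### §1. `ψ` in short intervals (Brun–Titchmarsh + Chebyshev) -/

/-- `ψ(b) − ψ(a) = Σ_{⌊a⌋ < d ≤ ⌊b⌋} Λ(d)` for `a ≤ b`. [folklore] -/
theorem psi_sub_psi_eq_sum {a b : ℝ} (hab : a ≤ b) :
    ψ b - ψ a = ∑ d ∈ Finset.Ioc ⌊a⌋₊ ⌊b⌋₊, Λ d := by
  rw [Chebyshev.psi, Chebyshev.psi, sub_eq_iff_eq_add,
    ← Finset.sum_Ioc_consecutive _ (Nat.zero_le ⌊a⌋₊) (Nat.floor_le_floor hab), add_comm]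

/-- **`ψ(X) − ψ(X − H) ≪ H` for `H ≥ 2`, `X ≤ H²`, `√X log X ≤ H`** (Brun–Titchmarsh for the primes
of `(X − H, X]`, and `ψ(X) − ϑ(X) ≤ 2√X log X` for the prime powers). The constant is absolute.
[cite: MontgomeryVaughanMathematika1973, Theorem 2 (any absolute constant)] -/
theorem exists_psi_sub_psi_le :
    ∃ K : ℝ, 0 < K ∧ ∀ X H : ℝ, 2 ≤ H → H ≤ X → Real.log X ≤ 2 * Real.log H →
      2 * Real.sqrt X * Real.log X ≤ H → ψ X - ψ (X - H) ≤ K * H := by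
  obtain ⟨C, hC, hBT⟩ := Literature.NumberTheory.Sieve.sum_log_primes_Ioc_le
  refine ⟨9 * C + 1, by positivity, fun X H hH2 hHX hlogX hsqrt => ?_⟩
  have hX2 : 2 ≤ X := hH2.trans hHX
  have hX0 : 0 < X := by linarith
  have hH0 : 0 < H := by linarith
  have hXH0 : 0 ≤ X - H := by linarith
  have hlogH : 0 < Real.log H := Real.log_pos (by linarith)
  have hlogH1 : 0.69 ≤ Real.log H := by
    have := Real.log_le_log two_pos hH2
    have := Real.log_two_gt_d9
    linarith
  rw [psi_sub_psi_eq_sum (by linarith : X - H ≤ X)]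
  set N : ℕ := ⌊X - H⌋₊ with hN
  set M : ℕ := ⌈H⌉₊ + 1 with hM
  have hM2 : 2 ≤ M := by rw [hM]; have := Nat.one_le_ceil_iff.2 hH0; omega
  -- `⌊X⌋ ≤ N + M`
  have hfloor : ⌊X⌋₊ ≤ N + M := by
    rw [hN, hM]
    have h1 : X ≤ (⌊X - H⌋₊ : ℝ) + 1 + ⌈H⌉₊ := by
      have := Nat.lt_floor_add_one (X - H)
      have := Nat.le_ceil H
      linarith
    have h2 : ⌊X⌋₊ ≤ ⌊(⌊X - H⌋₊ : ℝ) + 1 + ⌈H⌉₊⌋₊ := Nat.floor_le_floor h1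
    rw [show (⌊X - H⌋₊ : ℝ) + 1 + ⌈H⌉₊ = ((⌊X - H⌋₊ + 1 + ⌈H⌉₊ : ℕ) : ℝ) by push_cast; ring,
      Nat.floor_natCast] at h2
    omega
  -- split into primes and prime powers
  rw [← Finset.sum_filter_add_sum_filter_not _ Nat.Prime]
  -- (a) the primes
  have hprimes : ∑ d ∈ (Finset.Ioc N ⌊X⌋₊).filter Nat.Prime, Λ d ≤ 9 * C * H := by
    have hsub : (Finset.Ioc N ⌊X⌋₊).filter Nat.Prime ⊆ (Finset.Ioc N (N + M)).filter Nat.Prime := by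
      intro p hp
      simp only [Finset.mem_filter, Finset.mem_Ioc] at hp ⊢
      exact ⟨⟨hp.1.1, hp.1.2.trans hfloor⟩, hp.2⟩
    have h1 : ∑ d ∈ (Finset.Ioc N ⌊X⌋₊).filter Nat.Prime, Λ d ≤
        ∑ p ∈ (Finset.Ioc N (N + M)).filter Nat.Prime, Real.log p := by
      refine (Finset.sum_le_sum_of_subset_of_nonneg hsub fun _ _ _ =>
        ArithmeticFunction.vonMangoldt_nonneg).trans (Finset.sum_le_sum fun p hp => ?_)
      rw [ArithmeticFunction.vonMangoldt_apply_prime (Finset.mem_filter.1 hp).2]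
    refine h1.trans ((hBT N M hM2).trans ?_)
    -- `M ≤ 2H`, `log(N+M) ≤ 3.5 log H`, `log M ≥ log H`
    have hMle : (M : ℝ) ≤ 2 * H := by
      rw [hM]; push_cast
      have := (Nat.ceil_lt_add_one hH0.le).le
      linarith
    have hMge : H ≤ (M : ℝ) := by
      rw [hM]; push_cast
      have := Nat.le_ceil H
      linarith
    have hM0 : (0 : ℝ) < M := hH0.trans_le hMge
    have hlogM : Real.log H ≤ Real.log M := Real.log_le_log hH0 hMge
    have hNM : ((N + M : ℕ) : ℝ) ≤ 2 * X + 2 := by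
      push_cast
      rw [hN]
      have := Nat.floor_le hXH0
      linarith
    have hNM1 : (1 : ℝ) < ((N + M : ℕ) : ℝ) := by
      have : 1 < N + M := by omega
      exact_mod_cast this
    have hlogNM : Real.log ((N + M : ℕ) : ℝ) ≤ 4.1 * Real.log H := by
      have h2 : Real.log ((N + M : ℕ) : ℝ) ≤ Real.log (2 * X + 2) := Real.log_le_log (by linarith) hNM
      have h3 : Real.log (2 * X + 2) ≤ Real.log (4 * X) := Real.log_le_log (by linarith) (by linarith)
      have h4 : Real.log (4 * X) = Real.log 4 + Real.log X := Real.log_mul (by norm_num) hX0.ne'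
      have h5 : Real.log 4 < 1.4 := by
        have : Real.log 4 = 2 * Real.log 2 := by
          rw [show (4:ℝ) = 2 ^ 2 by norm_num, Real.log_pow]; ring
        rw [this]; linarith [Real.log_two_lt_d9]
      linarith
    have hlogNM0 : 0 ≤ Real.log ((N + M : ℕ) : ℝ) := Real.log_nonneg hNM1.le
    rw [div_le_iff₀ (hlogH.trans_le hlogM)]
    have key : C * H * Real.log H ≤ C * H * Real.log M := mul_le_mul_of_nonneg_left hlogM (by positivity)
    calc C * M * Real.log ((N + M : ℕ) : ℝ) ≤ C * (2 * H) * (4.1 * Real.log H) := by gcongr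
      _ = 8.2 * (C * H * Real.log H) := by ring
      _ ≤ 9 * (C * H * Real.log M) := by
          have hpos : 0 ≤ C * H * Real.log H := by positivity
          linarith [key, hpos]
      _ = 9 * C * H * Real.log M := by ring
  -- (b) the prime powers
  have hpowers : ∑ d ∈ (Finset.Ioc N ⌊X⌋₊).filter (fun d => ¬ Nat.Prime d), Λ d ≤ H := by
    have hsub : (Finset.Ioc N ⌊X⌋₊).filter (fun d => ¬ Nat.Prime d) ⊆
        (Finset.Ioc 0 ⌊X⌋₊).filter (fun d => ¬ Nat.Prime d) := by
      intro d hd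
      simp only [Finset.mem_filter, Finset.mem_Ioc] at hd ⊢
      exact ⟨⟨by omega, hd.1.2⟩, hd.2⟩
    calc ∑ d ∈ (Finset.Ioc N ⌊X⌋₊).filter (fun d => ¬ Nat.Prime d), Λ d
        ≤ ∑ d ∈ (Finset.Ioc 0 ⌊X⌋₊).filter (fun d => ¬ Nat.Prime d), Λ d :=
          Finset.sum_le_sum_of_subset_of_nonneg hsub fun _ _ _ => ArithmeticFunction.vonMangoldt_nonneg
      _ = ψ X - θ X := (Chebyshev.psi_sub_theta_eq_sum_not_prime X).symm
      _ ≤ 2 * Real.sqrt X * Real.log X := Chebyshev.psi_sub_theta_le (by linarith)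
      _ ≤ H := hsqrt
  calc _ ≤ 9 * C * H + H := add_le_add hprimes hpowers
    _ = (9 * C + 1) * H := by ring

/-! ### §2. `Σ_{d ≤ D} Λ(d)/d ≤ e (log D + K₀)` -/

/-- For `1 ≤ d ≤ D` (`D ≥ 3`): `1/d ≤ e · d^{-(1 + 1/log D)}`. [folklore] -/
theorem inv_le_exp_mul_rpow {d D : ℕ} (hd : 1 ≤ d) (hdD : d ≤ D) (hD : 3 ≤ D) :
    (d : ℝ)⁻¹ ≤ Real.exp 1 * (d : ℝ) ^ (-(1 + 1 / Real.log D)) := by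
  have hd0 : (0 : ℝ) < d := by exact_mod_cast hd
  have hD0 : (0 : ℝ) < D := by exact_mod_cast (show 0 < D by omega)
  have hlogD : 0 < Real.log D := Real.log_pos (by exact_mod_cast (show 1 < D by omega))
  have hlogd : 0 ≤ Real.log d := Real.log_nonneg (by exact_mod_cast hd)
  -- `d^{1/log D} ≤ e`
  have h1 : (d : ℝ) ^ (1 / Real.log D) ≤ Real.exp 1 := by
    rw [Real.rpow_def_of_pos hd0, Real.exp_le_exp]
    have : Real.log d ≤ Real.log D := Real.log_le_log hd0 (by exact_mod_cast hdD)
    rw [mul_one_div, div_le_one hlogD]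
    exact this
  have h2 : Real.exp (-1) ≤ (d : ℝ) ^ (-(1 / Real.log D)) := by
    rw [Real.rpow_neg hd0.le, Real.exp_neg]
    exact inv_anti₀ (Real.rpow_pos_of_pos hd0 _) h1
  calc (d : ℝ)⁻¹ = Real.exp 1 * ((d : ℝ)⁻¹ * Real.exp (-1)) := by
        rw [Real.exp_neg]; field_simp
    _ ≤ Real.exp 1 * ((d : ℝ)⁻¹ * (d : ℝ) ^ (-(1 / Real.log D))) := by gcongr
    _ = Real.exp 1 * (d : ℝ) ^ (-(1 + 1 / Real.log D)) := by
        rw [neg_add, Real.rpow_add hd0, Real.rpow_neg_one]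

/-- **`Σ_{d ≤ D} Λ(d)/d ≤ e(log D + K₀)`** for `D ≥ 3`, from `Σ Λ(n)n^{-σ} ≤ 1/(σ−1) + K₀` at
`σ = 1 + 1/log D`. [folklore] -/
theorem sum_vonMangoldt_div_le {K₀ : ℝ}
    (hK : ∀ σ : ℝ, 1 < σ → σ ≤ 2 →
      Summable (fun n : ℕ ↦ Λ n / (n : ℝ) ^ σ) ∧ ∑' n : ℕ, Λ n / (n : ℝ) ^ σ ≤ 1 / (σ - 1) + K₀)
    {D : ℕ} (hD : 3 ≤ D) :
    ∑ d ∈ Finset.Icc 1 D, Λ d / d ≤ Real.exp 1 * (Real.log D + K₀) := by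
  have hlogD : 1 < Real.log D := by
    have h3 : Real.log 3 ≤ Real.log D := Real.log_le_log (by norm_num) (by exact_mod_cast hD)
    have : 1 < Real.log 3 := by
      rw [Real.lt_log_iff_exp_lt (by norm_num)]
      have := Real.exp_one_lt_d9; linarith
    linarith
  set σ : ℝ := 1 + 1 / Real.log D with hσ
  have hσ1 : 1 < σ := by rw [hσ]; have := one_div_pos.2 (zero_lt_one.trans hlogD); linarith
  have hσ2 : σ ≤ 2 := by
    rw [hσ]; have : 1 / Real.log D ≤ 1 := (div_le_one (by linarith)).2 hlogD.le; linarith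
  obtain ⟨hsum, hle⟩ := hK σ hσ1 hσ2
  have hterm : ∀ d ∈ Finset.Icc 1 D, Λ d / d ≤ Real.exp 1 * (Λ d / (d : ℝ) ^ σ) := by
    intro d hd
    rw [Finset.mem_Icc] at hd
    have h := inv_le_exp_mul_rpow hd.1 hd.2 hD
    rw [div_eq_mul_inv, div_eq_mul_inv, ← Real.rpow_neg (Nat.cast_nonneg d), hσ]
    calc Λ d * (d : ℝ)⁻¹ ≤ Λ d * (Real.exp 1 * (d : ℝ) ^ (-(1 + 1 / Real.log D))) :=
          mul_le_mul_of_nonneg_left h ArithmeticFunction.vonMangoldt_nonneg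
      _ = Real.exp 1 * (Λ d * (d : ℝ) ^ (-(1 + 1 / Real.log D))) := by ring
  calc ∑ d ∈ Finset.Icc 1 D, Λ d / d ≤ ∑ d ∈ Finset.Icc 1 D, Real.exp 1 * (Λ d / (d : ℝ) ^ σ) :=
        Finset.sum_le_sum hterm
    _ = Real.exp 1 * ∑ d ∈ Finset.Icc 1 D, Λ d / (d : ℝ) ^ σ := by rw [Finset.mul_sum]
    _ ≤ Real.exp 1 * ∑' n : ℕ, Λ n / (n : ℝ) ^ σ := by
        refine mul_le_mul_of_nonneg_left (hsum.sum_le_tsum _ fun n _ => ?_) (Real.exp_pos 1).le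
        exact div_nonneg ArithmeticFunction.vonMangoldt_nonneg (Real.rpow_nonneg (Nat.cast_nonneg n) _)
    _ ≤ Real.exp 1 * (1 / (σ - 1) + K₀) := mul_le_mul_of_nonneg_left hle (Real.exp_pos 1).le
    _ = Real.exp 1 * (Real.log D + K₀) := by
        congr 1
        rw [hσ]
        field_simp
        ring

/-! ### §3. The partial sums `S₁` and `T₁` as step functions -/

/-- `|S₁(u)| ≤ ⌊u⌋` (each term has modulus `≤ 1/n ≤ 1`). [folklore] -/
theorem norm_S₁_le_floor (f : ℕ →*₀ ℂ) (hf : ∀ n, ‖f n‖ ≤ 1) (u : ℝ) : ‖S₁ f u‖ ≤ ⌊u⌋₊ := by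
  refine (norm_S₁_le f hf u).trans ?_
  calc ∑ n ∈ Finset.Icc 1 ⌊u⌋₊, (1 : ℝ) / n ≤ ∑ n ∈ Finset.Icc 1 ⌊u⌋₊, (1 : ℝ) := by
        refine Finset.sum_le_sum fun n hn => ?_
        rw [Finset.mem_Icc] at hn
        rw [div_le_one (by exact_mod_cast hn.1)]
        exact_mod_cast hn.1
    _ = ⌊u⌋₊ := by simp

/-- `|S₁(u)| ≤ u` for `u ≥ 0`. [folklore] -/
theorem norm_S₁_le_self (f : ℕ →*₀ ℂ) (hf : ∀ n, ‖f n‖ ≤ 1) {u : ℝ} (hu : 0 ≤ u) : ‖S₁ f u‖ ≤ u :=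
  (norm_S₁_le_floor f hf u).trans (Nat.floor_le hu)

/-- `S₁(u) = 0` for `u < 1`. [folklore] -/
theorem S₁_of_lt_one (f : ℕ → ℂ) {u : ℝ} (hu : u < 1) : S₁ f u = 0 :=
  MellinPlancherel.psum_of_lt_one (fun n => f n / n) hu

/-- `u ↦ |S₁(u)|` is measurable. [folklore] -/
theorem measurable_norm_S₁ (f : ℕ → ℂ) : Measurable fun u : ℝ => ‖S₁ f u‖ :=
  (MellinPlancherel.measurable_psum (fun n => f n / n)).norm

/-- **`∫_{(0,x]} |S₁(u)| du/u = ∫_0^{log x} |S₁(e^w)| dw`** (`x = e^L`, `L ≥ 0`; the substitution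
`u = e^w`, valid for the step function `S₁` by the change-of-variables formula for injective
differentiable maps). [folklore] -/
theorem setIntegral_norm_S₁_div_eq (f : ℕ → ℂ) {L : ℝ} (hL : 0 ≤ L) :
    ∫ u in Set.Ioc 0 (Real.exp L), ‖S₁ f u‖ / u = ∫ w in (0 : ℝ)..L, ‖S₁ f (Real.exp w)‖ := by
  have himage : Real.exp '' Set.Iic L = Set.Ioc 0 (Real.exp L) := Real.image_exp_Iic L
  have hderiv : ∀ w ∈ Set.Iic L, HasDerivWithinAt Real.exp (Real.exp w) (Set.Iic L) w :=
    fun w _ => (Real.hasDerivAt_exp w).hasDerivWithinAt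
  have h := integral_image_eq_integral_abs_deriv_smul measurableSet_Iic hderiv
    Real.exp_injective.injOn (fun u : ℝ => ‖S₁ f u‖ / u)
  rw [himage] at h
  rw [h]
  have hsimp : ∀ w : ℝ, |Real.exp w| • (‖S₁ f (Real.exp w)‖ / Real.exp w) = ‖S₁ f (Real.exp w)‖ := by
    intro w
    rw [abs_of_pos (Real.exp_pos w), smul_eq_mul, mul_div_cancel₀ _ (Real.exp_pos w).ne']
  simp_rw [hsimp]
  -- the integrand vanishes on `(-∞, 0)`: restrict to `[0, L]`
  have hcongr : ∀ w ∈ Set.Iic L, ‖S₁ f (Real.exp w)‖ = (Set.Icc 0 L).indicator (fun w => ‖S₁ f (Real.exp w)‖) w := by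
    intro w hw
    by_cases h0 : 0 ≤ w
    · rw [Set.indicator_of_mem (show w ∈ Set.Icc 0 L from ⟨h0, hw⟩)]
    · rw [Set.indicator_of_notMem (fun h => h0 h.1)]
      push Not at h0
      rw [S₁_of_lt_one f (Real.exp_lt_one_iff.2 h0), norm_zero]
  rw [setIntegral_congr_fun measurableSet_Iic hcongr, setIntegral_indicator measurableSet_Icc,
    Set.inter_eq_right.2 Set.Icc_subset_Iic_self, integral_Icc_eq_integral_Ioc,
    intervalIntegral.integral_of_le hL]

/-! ### §4. The bound for `T₁(x)` -/

/-- `Icc 1 N = Ioc 0 N` in `ℕ` (a private copy of a one-line helper also found elsewhere in the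
tree). [folklore] -/
private theorem Icc_one_eq_Ioc_zero (N : ℕ) : Finset.Icc 1 N = Finset.Ioc 0 N := by
  ext n; simp only [Finset.mem_Icc, Finset.mem_Ioc]; omega

/-- `f(n)/n` is completely multiplicative when `f` is. [folklore] -/
theorem div_mul_div_natCast (f : ℕ →*₀ ℂ) (m n : ℕ) :
    f (m * n) / ((m * n : ℕ) : ℂ) = f m / m * (f n / n) := by
  rw [map_mul, Nat.cast_mul, mul_div_mul_comm]

/-- `|f(n) log n / n| ≤ log x / v` for `v < n ≤ x` (`v > 0`). [folklore] -/
theorem norm_mul_log_div_le (f : ℕ →*₀ ℂ) (hf : ∀ n, ‖f n‖ ≤ 1) {x v : ℝ} (hv : 0 < v) {n : ℕ}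
    (hvn : v < n) (hnx : (n : ℝ) ≤ x) :
    ‖f n * (Real.log n : ℂ) / n‖ ≤ Real.log x / v := by
  have hn0 : (0 : ℝ) < n := hv.trans hvn
  have hn1 : 1 ≤ n := Nat.one_le_iff_ne_zero.2 (by rintro rfl; simp at hn0)
  have hlog0 : 0 ≤ Real.log n := Real.log_nonneg (by exact_mod_cast hn1)
  rw [norm_div, norm_mul, Complex.norm_real, Complex.norm_natCast, Real.norm_of_nonneg hlog0]
  calc ‖f n‖ * Real.log n / n ≤ Real.log n / n :=
        div_le_div_of_nonneg_right (mul_le_of_le_one_left hlog0 (hf n)) hn0.le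
    _ ≤ Real.log x / n := div_le_div_of_nonneg_right (Real.log_le_log hn0 hnx) hn0.le
    _ ≤ Real.log x / v :=
        div_le_div_of_nonneg_left (hlog0.trans (Real.log_le_log hn0 hnx)) hv hvn.le

/-- `|f(n) log n / n| ≤ log x` for `1 ≤ n ≤ x`. [folklore] -/
theorem norm_mul_log_div_le' (f : ℕ →*₀ ℂ) (hf : ∀ n, ‖f n‖ ≤ 1) {x : ℝ} {n : ℕ} (hn : 1 ≤ n)
    (hnx : (n : ℝ) ≤ x) : ‖f n * (Real.log n : ℂ) / n‖ ≤ Real.log x := by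
  have hn0 : (0 : ℝ) < n := by exact_mod_cast hn
  have hlog0 : 0 ≤ Real.log n := Real.log_nonneg (by exact_mod_cast hn)
  rw [norm_div, norm_mul, Complex.norm_real, Complex.norm_natCast, Real.norm_of_nonneg hlog0]
  calc ‖f n‖ * Real.log n / n ≤ Real.log n / n :=
        div_le_div_of_nonneg_right (mul_le_of_le_one_left hlog0 (hf n)) hn0.le
    _ ≤ Real.log n := div_le_self hlog0 (by exact_mod_cast hn)
    _ ≤ Real.log x := Real.log_le_log hn0 hnx

/-- **Step (a): `|T₁(x) − T₁(v)| ≤ 3` for `x − x/log x ≤ v ≤ x`**, `x ≥ e^{500}`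
("`T₁(x) − T₁(v) ≪ Σ_{x−h ≤ n ≤ x} log n/n ≪ 1`"). [cite: RoyVatwani2019, §6.1] -/
theorem norm_T₁_sub_le (f : ℕ →*₀ ℂ) (hf : ∀ n, ‖f n‖ ≤ 1) {x : ℝ} (hx : Real.exp 500 ≤ x) {v : ℝ}
    (hv : v ∈ Set.Icc (x - x / Real.log x) x) :
    ‖psum (fun n => f n * (Real.log n : ℂ) / n) x - psum (fun n => f n * (Real.log n : ℂ) / n) v‖ ≤ 3 := by
  have hx0 : 0 < x := (Real.exp_pos _).trans_le hx
  set L : ℝ := Real.log x with hL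
  have hL500 : 500 ≤ L := by rw [hL, Real.le_log_iff_exp_le hx0]; exact hx
  have hL0 : 0 < L := by linarith
  have hLx : L ≤ x := by rw [hL]; linarith [Real.log_le_sub_one_of_pos hx0]
  set h : ℝ := x / L with hh
  have hhL : h * L = x := by rw [hh]; field_simp
  have hxh0 : 0 < x - h := by
    have : h ≤ x / 2 := by rw [hh]; exact div_le_div_of_nonneg_left hx0.le two_pos (by linarith)
    linarith
  have hv0 : 0 < v := hxh0.trans_le hv.1
  set b : ℕ → ℂ := fun n => f n * (Real.log n : ℂ) / n with hb
  have hvX : ⌊v⌋₊ ≤ ⌊x⌋₊ := Nat.floor_le_floor hv.2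
  have hdiff : psum b x - psum b v = ∑ n ∈ Finset.Ioc ⌊v⌋₊ ⌊x⌋₊, b n := by
    simp only [MellinPlancherel.psum, Icc_one_eq_Ioc_zero]
    rw [← Finset.sum_Ioc_consecutive b (Nat.zero_le ⌊v⌋₊) hvX]
    ring
  rw [hdiff]
  have hcount : ((Finset.Ioc ⌊v⌋₊ ⌊x⌋₊).card : ℝ) ≤ h + 1 := by
    rw [Nat.card_Ioc, Nat.cast_sub hvX]
    have h2 : v < (⌊v⌋₊ : ℝ) + 1 := Nat.lt_floor_add_one v
    have h3 : (⌊x⌋₊ : ℝ) ≤ x := Nat.floor_le hx0.le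
    linarith [hv.1]
  calc ‖∑ n ∈ Finset.Ioc ⌊v⌋₊ ⌊x⌋₊, b n‖ ≤ ∑ n ∈ Finset.Ioc ⌊v⌋₊ ⌊x⌋₊, ‖b n‖ := norm_sum_le _ _
    _ ≤ ∑ n ∈ Finset.Ioc ⌊v⌋₊ ⌊x⌋₊, L / v := by
        refine Finset.sum_le_sum fun n hn => ?_
        rw [Finset.mem_Ioc] at hn
        have hvn : v < n := by
          have : (⌊v⌋₊ : ℝ) + 1 ≤ n := by exact_mod_cast hn.1
          linarith [Nat.lt_floor_add_one v]
        exact norm_mul_log_div_le f hf hv0 hvn ((Nat.cast_le.2 hn.2).trans (Nat.floor_le hx0.le))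
    _ = (Finset.Ioc ⌊v⌋₊ ⌊x⌋₊).card * (L / v) := by rw [Finset.sum_const, nsmul_eq_mul]
    _ ≤ (h + 1) * (L / (x - h)) :=
        mul_le_mul hcount (div_le_div_of_nonneg_left hL0.le hxh0 hv.1) (by positivity) (by positivity)
    _ ≤ 3 := by
        rw [mul_div_assoc', div_le_iff₀ hxh0]
        have : 3 * x / L ≤ 3 * x / 500 := div_le_div_of_nonneg_left (by positivity) (by norm_num) hL500
        have h3 : 3 * (x / L) = 3 * x / L := by ring
        nlinarith [hhL]

/-- **Step (c): `|T₁(v)| ≤ Σ_{d ≤ x} (Λ(d)/d)|S₁(v/d)|`** for `0 ≤ v ≤ x` (from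
`f(n) log n = Σ_{d|n} f(d)Λ(d)f(n/d)`). [cite: RoyVatwani2019, §6.1 (eq:bdT1)] -/
theorem norm_T₁_le_sum (f : ℕ →*₀ ℂ) (hf : ∀ n, ‖f n‖ ≤ 1) {x v : ℝ} (hvx : v ≤ x) :
    ‖psum (fun n => f n * (Real.log n : ℂ) / n) v‖ ≤
      ∑ d ∈ Finset.Icc 1 ⌊x⌋₊, Λ d / d * ‖S₁ f (v / d)‖ := by
  have hvX : ⌊v⌋₊ ≤ ⌊x⌋₊ := Nat.floor_le_floor hvx
  set g : ℕ → ℂ := fun n => f n / n with hg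
  have hgmul : ∀ m n, g (m * n) = g m * g n := fun m n => div_mul_div_natCast f m n
  have hid := Halasz.sum_mul_log_eq (g := g) hgmul v
  have hTv' : psum (fun n => f n * (Real.log n : ℂ) / n) v = ∑ n ∈ Finset.Icc 1 ⌊v⌋₊, g n * (Real.log n : ℂ) := by
    simp only [MellinPlancherel.psum, hg]
    refine Finset.sum_congr rfl fun n _ => ?_
    ring
  rw [hTv', hid]
  calc ‖∑ d ∈ Finset.Icc 1 ⌊v⌋₊, (Λ d : ℂ) * g d * Halasz.S g (v / d)‖
      ≤ ∑ d ∈ Finset.Icc 1 ⌊v⌋₊, ‖(Λ d : ℂ) * g d * Halasz.S g (v / d)‖ := norm_sum_le _ _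
    _ ≤ ∑ d ∈ Finset.Icc 1 ⌊v⌋₊, Λ d / d * ‖S₁ f (v / d)‖ := by
        refine Finset.sum_le_sum fun d hd => ?_
        rw [Finset.mem_Icc] at hd
        have hd0 : (0 : ℝ) < d := by exact_mod_cast hd.1
        have hS : Halasz.S g (v / d) = S₁ f (v / d) := rfl
        rw [norm_mul, norm_mul, Complex.norm_real, Real.norm_of_nonneg ArithmeticFunction.vonMangoldt_nonneg,
          hS, hg]
        simp only
        rw [norm_div, Complex.norm_natCast]
        have : ‖f d‖ / d ≤ 1 / d := div_le_div_of_nonneg_right (hf d) hd0.le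
        calc Λ d * (‖f d‖ / d) * ‖S₁ f (v / d)‖ ≤ Λ d * (1 / d) * ‖S₁ f (v / d)‖ :=
              mul_le_mul_of_nonneg_right (mul_le_mul_of_nonneg_left this ArithmeticFunction.vonMangoldt_nonneg)
                (norm_nonneg _)
          _ = Λ d / d * ‖S₁ f (v / d)‖ := by ring
    _ ≤ ∑ d ∈ Finset.Icc 1 ⌊x⌋₊, Λ d / d * ‖S₁ f (v / d)‖ := by
        refine Finset.sum_le_sum_of_subset_of_nonneg (Finset.Icc_subset_Icc_right hvX) fun d _ _ => ?_
        exact mul_nonneg (div_nonneg ArithmeticFunction.vonMangoldt_nonneg (Nat.cast_nonneg d)) (norm_nonneg _)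

/-- A crude bound for integrability: `|T₁(v)| ≤ x log x` for `v ≤ x`, `x ≥ 1`. [folklore] -/
theorem norm_T₁_le_mul_log (f : ℕ →*₀ ℂ) (hf : ∀ n, ‖f n‖ ≤ 1) {x v : ℝ} (hx : 1 ≤ x) (hvx : v ≤ x) :
    ‖psum (fun n => f n * (Real.log n : ℂ) / n) v‖ ≤ x * Real.log x := by
  have hL0 : 0 ≤ Real.log x := Real.log_nonneg hx
  refine (MellinPlancherel.norm_psum_le _ v).trans ?_
  rcases lt_or_ge v 0 with hv | hv
  · rw [Nat.floor_of_nonpos hv.le, show Finset.Icc 1 0 = ∅ by decide, Finset.sum_empty]; positivity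
  calc ∑ n ∈ Finset.Icc 1 ⌊v⌋₊, ‖f n * (Real.log n : ℂ) / n‖ ≤ ∑ n ∈ Finset.Icc 1 ⌊v⌋₊, Real.log x := by
        refine Finset.sum_le_sum fun n hn => ?_
        rw [Finset.mem_Icc] at hn
        exact norm_mul_log_div_le' f hf hn.1 (le_trans (by exact_mod_cast hn.2) ((Nat.floor_le hv).trans hvx))
    _ = ⌊v⌋₊ * Real.log x := by rw [Finset.sum_const, Nat.card_Icc, nsmul_eq_mul]; push_cast; ring
    _ ≤ x * Real.log x := mul_le_mul_of_nonneg_right ((Nat.floor_le hv).trans hvx) hL0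

/-- **The small `d`** (`d ≤ D₀ = ⌊log⁵ x⌋`; Roy–Vatwani (eq:int2)): for `x ≥ e^{500}`,
`h = x/log x`, and `M` with `|S₁(u)| log u ≤ M` on `1 ≤ u ≤ x`,
`Σ_{d ≤ D₀} Λ(d) ∫_{(x−h)/d}^{x/d} |S₁(u)| du ≤ (2Mh/log x) · e (5 log log x + K₀)`.
[cite: RoyVatwani2019, §6.1 (eq:int2)] -/
theorem sum_small_le {K₀ : ℝ}
    (hK : ∀ σ : ℝ, 1 < σ → σ ≤ 2 →
      Summable (fun n : ℕ ↦ Λ n / (n : ℝ) ^ σ) ∧ ∑' n : ℕ, Λ n / (n : ℝ) ^ σ ≤ 1 / (σ - 1) + K₀)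
    (f : ℕ →*₀ ℂ) {x : ℝ} (hx : Real.exp 500 ≤ x)
    {M : ℝ} (hM0 : 0 ≤ M) (hM : ∀ u : ℝ, 1 ≤ u → u ≤ x → ‖S₁ f u‖ * Real.log u ≤ M) :
    ∑ d ∈ Finset.Icc 1 ⌊Real.log x ^ 5⌋₊,
        Λ d * ∫ u in (x - x / Real.log x) / d..x / d, ‖S₁ f u‖ ≤
      2 * M * (x / Real.log x) / Real.log x *
        (Real.exp 1 * (5 * Real.log (Real.log x) + K₀)) := by
  have hx0 : 0 < x := (Real.exp_pos _).trans_le hx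
  set L : ℝ := Real.log x with hL
  have hL500 : 500 ≤ L := by rw [hL, Real.le_log_iff_exp_le hx0]; exact hx
  have hL0 : 0 < L := by linarith
  set h : ℝ := x / L with hh
  have hh0 : 0 < h := div_pos hx0 hL0
  have hh2 : h ≤ x / 2 := by rw [hh]; exact div_le_div_of_nonneg_left hx0.le two_pos (by linarith)
  have hxh0 : 0 < x - h := by linarith
  set D₀ : ℕ := ⌊L ^ 5⌋₊ with hD₀
  have hL5 : (3 : ℝ) ≤ L ^ 5 := by nlinarith [pow_le_pow_left₀ (by norm_num : (0:ℝ) ≤ 3) (show (3:ℝ) ≤ L by linarith) 5]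
  have hD₀3 : 3 ≤ D₀ := by rw [hD₀]; exact Nat.le_floor (by exact_mod_cast hL5)
  have hD₀le : (D₀ : ℝ) ≤ L ^ 5 := Nat.floor_le (by positivity)
  have hD₀0 : (0 : ℝ) < D₀ := by exact_mod_cast (show 0 < D₀ by omega)
  -- `log 2 + 5 log L ≤ L/2` (via `log L ≤ 2√L`, `√L ≥ 22`)
  have hnum : Real.log 2 + 5 * Real.log L ≤ L / 2 := by
    have hsqrtL : 22 ≤ Real.sqrt L := by
      rw [show (22 : ℝ) = Real.sqrt (22 ^ 2) by rw [Real.sqrt_sq (by norm_num)]]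
      exact Real.sqrt_le_sqrt (by linarith)
    have hlogL : Real.log L ≤ 2 * Real.sqrt L := by
      have := Real.log_le_rpow_div hL0.le (by norm_num : (0 : ℝ) < 1 / 2)
      rw [← Real.sqrt_eq_rpow] at this
      linarith
    have hsq : Real.sqrt L * Real.sqrt L = L := Real.mul_self_sqrt hL0.le
    have hl2 : Real.log 2 < 0.7 := by have := Real.log_two_lt_d9; linarith
    nlinarith
  -- on `[(x-h)/d, x/d]` with `d ≤ D₀`: `log u ≥ L/2`, so `|S₁(u)| ≤ 2M/L`
  have hterm : ∀ d ∈ Finset.Icc 1 D₀, Λ d * ∫ u in (x - h) / d..x / d, ‖S₁ f u‖ ≤ Λ d / d * (2 * M * h / L) := by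
    intro d hd
    rw [Finset.mem_Icc] at hd
    have hd0 : (0 : ℝ) < d := by exact_mod_cast hd.1
    have hdD : (d : ℝ) ≤ D₀ := by exact_mod_cast hd.2
    have hpos : 0 < x / (2 * L ^ 5) := by positivity
    have hbound : ∀ u ∈ Set.uIoc ((x - h) / d) (x / d), ‖(‖S₁ f u‖)‖ ≤ 2 * M / L := by
      intro u hu
      rw [Set.uIoc_of_le (div_le_div_of_nonneg_right (by linarith) hd0.le)] at hu
      rw [Real.norm_eq_abs, abs_of_nonneg (norm_nonneg _)]
      have hu1 : x / (2 * L ^ 5) < u := by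
        have h1 : (x - h) / (D₀ : ℝ) ≤ (x - h) / d := div_le_div_of_nonneg_left hxh0.le hd0 hdD
        have h2 : x / (2 * L ^ 5) ≤ (x - h) / D₀ := by
          rw [div_le_div_iff₀ (by positivity) hD₀0]
          nlinarith [hD₀le, hh2]
        linarith [hu.1]
      have hux : u ≤ x := hu.2.trans (div_le_self hx0.le (by exact_mod_cast hd.1))
      have hlogu : L / 2 ≤ Real.log u := by
        have h1 : Real.log (x / (2 * L ^ 5)) ≤ Real.log u := Real.log_le_log hpos hu1.le
        have h2 : Real.log (x / (2 * L ^ 5)) = L - (Real.log 2 + 5 * Real.log L) := by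
          rw [Real.log_div hx0.ne' (by positivity), Real.log_mul two_ne_zero (by positivity), Real.log_pow, ← hL]
          push_cast; ring
        linarith
      have hu1' : 1 < u := by
        by_contra hcon
        push Not at hcon
        have : Real.log u ≤ 0 := Real.log_nonpos (by linarith) hcon
        linarith
      calc ‖S₁ f u‖ ≤ M / Real.log u := by
            rw [le_div_iff₀ (Real.log_pos hu1')]; exact hM u hu1'.le hux
        _ ≤ M / (L / 2) := div_le_div_of_nonneg_left hM0 (by linarith) hlogu
        _ = 2 * M / L := by field_simp
    have hI := intervalIntegral.norm_integral_le_of_norm_le_const hbound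
    rw [Real.norm_eq_abs, abs_of_nonneg (intervalIntegral.integral_nonneg
      (div_le_div_of_nonneg_right (by linarith) hd0.le) fun u _ => norm_nonneg _),
      show x / d - (x - h) / d = h / d by ring, abs_of_pos (div_pos hh0 hd0)] at hI
    calc Λ d * ∫ u in (x - h) / d..x / d, ‖S₁ f u‖ ≤ Λ d * (2 * M / L * (h / d)) :=
          mul_le_mul_of_nonneg_left hI ArithmeticFunction.vonMangoldt_nonneg
      _ = Λ d / d * (2 * M * h / L) := by field_simp
  calc ∑ d ∈ Finset.Icc 1 D₀, Λ d * ∫ u in (x - h) / d..x / d, ‖S₁ f u‖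
      ≤ ∑ d ∈ Finset.Icc 1 D₀, Λ d / d * (2 * M * h / L) := Finset.sum_le_sum hterm
    _ = (∑ d ∈ Finset.Icc 1 D₀, Λ d / d) * (2 * M * h / L) := by rw [Finset.sum_mul]
    _ ≤ Real.exp 1 * (Real.log D₀ + K₀) * (2 * M * h / L) :=
        mul_le_mul_of_nonneg_right (sum_vonMangoldt_div_le hK hD₀3) (by positivity)
    _ ≤ Real.exp 1 * (5 * Real.log L + K₀) * (2 * M * h / L) := by
        gcongr
        calc Real.log D₀ ≤ Real.log (L ^ 5) := Real.log_le_log hD₀0 hD₀le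
          _ = 5 * Real.log L := by rw [Real.log_pow]; push_cast; ring
    _ = 2 * M * h / L * (Real.exp 1 * (5 * Real.log L + K₀)) := by ring

/-- **The window count for the large `d`**: for `x ≥ e^{500}`, `h = x/log x`, `D₀ = ⌊log⁵ x⌋` and
`1 ≤ u ≤ x`, `Σ_{d > D₀, (x−h)/d < u ≤ x/d} Λ(d) ≤ K_N h/u` — empty unless `x/u > D₀`, and then
`= ψ(x/u) − ψ(x/u − h/u)` is a short interval of length `(x/u)/log x` at height `x/u ≥ log⁵ x`.
[cite: RoyVatwani2019, §6.1 (eq:primebound)] -/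
theorem window_vonMangoldt_sum_le {KN : ℝ} (hKN : 0 < KN)
    (hBT : ∀ X H : ℝ, 2 ≤ H → H ≤ X → Real.log X ≤ 2 * Real.log H →
      2 * Real.sqrt X * Real.log X ≤ H → ψ X - ψ (X - H) ≤ KN * H)
    {x : ℝ} (hx : Real.exp 500 ≤ x) {u : ℝ} (hu1 : 1 ≤ u) :
    ∑ d ∈ ((Finset.Icc 1 ⌊x⌋₊).filter (fun d => ¬ d ≤ ⌊Real.log x ^ 5⌋₊)).filter
        (fun d : ℕ => u ∈ Set.Ioc ((x - x / Real.log x) / (d : ℝ)) (x / (d : ℝ))), Λ d ≤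
      KN * (x / Real.log x) / u := by
  have hx0 : 0 < x := (Real.exp_pos _).trans_le hx
  have hu0 : 0 < u := by linarith
  set L : ℝ := Real.log x with hL
  have hL500 : 500 ≤ L := by rw [hL, Real.le_log_iff_exp_le hx0]; exact hx
  have hL0 : 0 < L := by linarith
  have hL1 : 1 ≤ L := by linarith
  set h : ℝ := x / L with hh
  have hh0 : 0 < h := div_pos hx0 hL0
  have hh2 : h ≤ x / 2 := by rw [hh]; exact div_le_div_of_nonneg_left hx0.le two_pos (by linarith)
  have hxh0 : 0 < x - h := by linarith
  set D₀ : ℕ := ⌊L ^ 5⌋₊ with hD₀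
  have hD₀gt : L ^ 5 < (D₀ : ℝ) + 1 := Nat.lt_floor_add_one _
  set F := (Finset.Icc 1 ⌊x⌋₊).filter (fun d => ¬ d ≤ D₀) with hF
  rcases lt_or_ge (x / u) ((D₀ : ℝ) + 1) with hcase | hcase
  · -- no `d > D₀` with `u ≤ x/d`
    have hempty : F.filter (fun d : ℕ => u ∈ Set.Ioc ((x - h) / (d : ℝ)) (x / (d : ℝ))) = ∅ := by
      rw [Finset.filter_eq_empty_iff]
      intro d hd hmem
      have hd' := Finset.mem_filter.1 hd
      have hdD : (D₀ : ℝ) + 1 ≤ d := by exact_mod_cast (show D₀ + 1 ≤ d by omega)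
      have hd0 : (0 : ℝ) < d := by linarith
      have h1 : u ≤ x / d := hmem.2
      rw [le_div_iff₀ hd0] at h1
      have h2 : x < ((D₀ : ℝ) + 1) * u := by rwa [div_lt_iff₀ hu0] at hcase
      nlinarith
    rw [hempty, Finset.sum_empty]
    positivity
  · -- Brun–Titchmarsh on `(x/u − h/u, x/u]`
    set Xu : ℝ := x / u with hXu
    set Hu : ℝ := h / u with hHu
    have hXuL5 : L ^ 5 ≤ Xu := by linarith
    have hXux : Xu ≤ x := div_le_self hx0.le hu1
    have hXu0 : 0 < Xu := by linarith [pow_pos hL0 5]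
    have hHuXu : Hu = Xu / L := by rw [hHu, hXu, hh]; field_simp
    have hL4 : L ^ 4 ≤ Hu := by
      rw [hHuXu, le_div_iff₀ hL0]; nlinarith
    have hHu2 : 2 ≤ Hu := by
      have : (2 : ℝ) ^ 4 ≤ L ^ 4 := pow_le_pow_left₀ (by norm_num) (by linarith) 4
      linarith
    have hHuXu' : Hu ≤ Xu := by rw [hHuXu]; exact div_le_self hXu0.le hL1
    have hlogXu : Real.log Xu ≤ 2 * Real.log Hu := by
      rw [hHuXu, Real.log_div hXu0.ne' hL0.ne']
      have h1 : Real.log (L ^ 2) ≤ Real.log Xu := Real.log_le_log (by positivity) (by nlinarith)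
      rw [Real.log_pow] at h1; push_cast at h1
      linarith
    have hsqrtXu : 2 * Real.sqrt Xu * Real.log Xu ≤ Hu := by
      have hlx : Real.log Xu ≤ L := by rw [hL]; exact Real.log_le_log hXu0 hXux
      have hs0 : 0 ≤ Real.sqrt Xu := Real.sqrt_nonneg _
      have hsq : Real.sqrt Xu * Real.sqrt Xu = Xu := Real.mul_self_sqrt hXu0.le
      have hsL : 2 * L ^ 2 ≤ Real.sqrt Xu := by
        rw [show 2 * L ^ 2 = Real.sqrt ((2 * L ^ 2) ^ 2) by rw [Real.sqrt_sq (by positivity)]]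
        exact Real.sqrt_le_sqrt (by nlinarith)
      rw [hHuXu, le_div_iff₀ hL0]
      have hlog0 : 0 ≤ Real.log Xu := Real.log_nonneg (by nlinarith)
      calc 2 * Real.sqrt Xu * Real.log Xu * L ≤ 2 * Real.sqrt Xu * L * L := by
            have := mul_le_mul_of_nonneg_left hlx (by positivity : 0 ≤ 2 * Real.sqrt Xu * L)
            nlinarith
        _ = Real.sqrt Xu * (2 * L ^ 2) := by ring
        _ ≤ Real.sqrt Xu * Real.sqrt Xu := mul_le_mul_of_nonneg_left hsL hs0
        _ = Xu := hsq
    have hBTu := hBT Xu Hu hHu2 hHuXu' hlogXu hsqrtXu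
    have hXH0 : 0 ≤ Xu - Hu := by linarith
    -- the window sum is dominated by `ψ(Xu) − ψ(Xu − Hu)`
    have hsub : F.filter (fun d : ℕ => u ∈ Set.Ioc ((x - h) / (d : ℝ)) (x / (d : ℝ))) ⊆
        Finset.Ioc ⌊Xu - Hu⌋₊ ⌊Xu⌋₊ := by
      intro d hd
      rw [Finset.mem_filter] at hd
      have hd' := (Finset.mem_filter.1 hd.1).1
      rw [Finset.mem_Icc] at hd'
      have hd0 : (0 : ℝ) < d := by exact_mod_cast hd'.1
      obtain ⟨h1, h2⟩ := hd.2
      rw [Finset.mem_Ioc]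
      constructor
      · rw [Nat.floor_lt hXH0]
        rw [hXu, hHu, show x / u - h / u = (x - h) / u by ring, div_lt_iff₀ hu0]
        rw [div_lt_iff₀ hd0] at h1
        linarith
      · refine Nat.le_floor ?_
        rw [hXu, le_div_iff₀ hu0]
        rw [le_div_iff₀ hd0] at h2
        linarith
    calc ∑ d ∈ F.filter (fun d : ℕ => u ∈ Set.Ioc ((x - h) / (d : ℝ)) (x / (d : ℝ))), Λ d
        ≤ ∑ d ∈ Finset.Ioc ⌊Xu - Hu⌋₊ ⌊Xu⌋₊, Λ d :=
          Finset.sum_le_sum_of_subset_of_nonneg hsub fun _ _ _ => ArithmeticFunction.vonMangoldt_nonneg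
      _ = ψ Xu - ψ (Xu - Hu) := (psi_sub_psi_eq_sum (by linarith)).symm
      _ ≤ KN * Hu := hBTu
      _ = KN * h / u := by rw [hHu]; ring

/-- **The large `d`** (`d > D₀`; Roy–Vatwani (eq:int1)): interchanging `Σ_d` and `∫ du`,
`Σ_{D₀ < d ≤ x} Λ(d) ∫_{(x−h)/d}^{x/d} |S₁(u)| du ≤ K_N h ∫_0^{log x} |S₁(e^w)| dw`.
[cite: RoyVatwani2019, §6.1 (eq:int1)] -/
theorem sum_large_le {KN : ℝ} (hKN : 0 < KN)
    (hBT : ∀ X H : ℝ, 2 ≤ H → H ≤ X → Real.log X ≤ 2 * Real.log H →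
      2 * Real.sqrt X * Real.log X ≤ H → ψ X - ψ (X - H) ≤ KN * H)
    (f : ℕ →*₀ ℂ) (hf : ∀ n, ‖f n‖ ≤ 1) {x : ℝ} (hx : Real.exp 500 ≤ x) :
    ∑ d ∈ (Finset.Icc 1 ⌊x⌋₊).filter (fun d => ¬ d ≤ ⌊Real.log x ^ 5⌋₊),
        Λ d * ∫ u in (x - x / Real.log x) / d..x / d, ‖S₁ f u‖ ≤
      KN * (x / Real.log x) * ∫ w in (0 : ℝ)..Real.log x, ‖S₁ f (Real.exp w)‖ := by
  have hx0 : 0 < x := (Real.exp_pos _).trans_le hx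
  set L : ℝ := Real.log x with hL
  have hL500 : 500 ≤ L := by rw [hL, Real.le_log_iff_exp_le hx0]; exact hx
  have hL0 : 0 < L := by linarith
  have hxexp : Real.exp L = x := by rw [hL, Real.exp_log hx0]
  set h : ℝ := x / L with hh
  have hh0 : 0 < h := div_pos hx0 hL0
  have hh2 : h ≤ x / 2 := by rw [hh]; exact div_le_div_of_nonneg_left hx0.le two_pos (by linarith)
  have hxh0 : 0 < x - h := by linarith
  set F := (Finset.Icc 1 ⌊x⌋₊).filter (fun d => ¬ d ≤ ⌊L ^ 5⌋₊) with hF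
  set sS : ℝ → ℝ := fun u => ‖S₁ f u‖ with hsS
  have hsS0 : ∀ u, 0 ≤ sS u := fun u => norm_nonneg _
  have hsSle : ∀ u, 0 ≤ u → sS u ≤ u := fun u hu => norm_S₁_le_self f hf hu
  have hsSmeas : Measurable sS := measurable_norm_S₁ f
  -- each integral as an integral over `(0, x]` of an indicator
  have hind : ∀ d ∈ F, ∫ u in (x - h) / d..x / d, sS u =
      ∫ u in Set.Ioc 0 x, (Set.Ioc ((x - h) / d) (x / d)).indicator sS u := by
    intro d hd
    have hd' := (Finset.mem_filter.1 hd).1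
    rw [Finset.mem_Icc] at hd'
    have hd0 : (0 : ℝ) < d := by exact_mod_cast hd'.1
    have hsub : Set.Ioc ((x - h) / d) (x / d) ⊆ Set.Ioc 0 x := fun u hu =>
      ⟨(div_nonneg hxh0.le hd0.le).trans_lt hu.1, hu.2.trans (div_le_self hx0.le (by exact_mod_cast hd'.1))⟩
    rw [intervalIntegral.integral_of_le (div_le_div_of_nonneg_right (by linarith) hd0.le),
      setIntegral_indicator measurableSet_Ioc, Set.inter_eq_right.2 hsub]
  rw [Finset.sum_congr rfl fun d hd => by rw [hind d hd]]
  have hinteg : ∀ d ∈ F, Integrable (fun u => Λ d * (Set.Ioc ((x - h) / d) (x / d)).indicator sS u)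
      (volume.restrict (Set.Ioc 0 x)) := by
    intro d _
    refine Integrable.const_mul ?_ _
    refine ((Measure.integrableOn_of_bounded (M := x) measure_Ioc_lt_top.ne hsSmeas.aestronglyMeasurable ?_)).indicator
      measurableSet_Ioc
    refine (ae_restrict_iff' measurableSet_Ioc).2 (Filter.Eventually.of_forall fun u hu => ?_)
    rw [Real.norm_eq_abs, abs_of_nonneg (hsS0 u)]
    exact (hsSle u hu.1.le).trans hu.2
  have hswap : (∑ d ∈ F, Λ d * ∫ u in Set.Ioc 0 x, (Set.Ioc ((x - h) / d) (x / d)).indicator sS u) =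
      ∫ u in Set.Ioc 0 x, ∑ d ∈ F, Λ d * (Set.Ioc ((x - h) / d) (x / d)).indicator sS u := by
    rw [MeasureTheory.integral_finsetSum _ hinteg]
    refine Finset.sum_congr rfl fun d _ => ?_
    rw [MeasureTheory.integral_const_mul]
  rw [hswap]
  -- pointwise bound
  have hpt : ∀ u ∈ Set.Ioc 0 x, ∑ d ∈ F, Λ d * (Set.Ioc ((x - h) / d) (x / d)).indicator sS u ≤
      KN * h * (sS u / u) := by
    intro u hu
    have hu0 : 0 < u := hu.1
    have hrw : ∑ d ∈ F, Λ d * (Set.Ioc ((x - h) / d) (x / d)).indicator sS u =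
        (∑ d ∈ F.filter (fun d : ℕ => u ∈ Set.Ioc ((x - h) / (d : ℝ)) (x / (d : ℝ))), Λ d) * sS u := by
      conv_rhs => rw [Finset.sum_mul, Finset.sum_filter]
      refine Finset.sum_congr rfl fun d _ => ?_
      by_cases hmem : u ∈ Set.Ioc ((x - h) / (d : ℝ)) (x / (d : ℝ))
      · rw [Set.indicator_of_mem hmem, if_pos hmem]
      · rw [Set.indicator_of_notMem hmem, if_neg hmem, mul_zero]
    rw [hrw]
    rcases lt_or_ge u 1 with hu1 | hu1
    · have : sS u = 0 := by simp only [hsS]; rw [S₁_of_lt_one f hu1, norm_zero]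
      rw [this, mul_zero, zero_div, mul_zero]
    · have hN := window_vonMangoldt_sum_le hKN hBT hx hu1
      calc (∑ d ∈ F.filter (fun d : ℕ => u ∈ Set.Ioc ((x - h) / (d : ℝ)) (x / (d : ℝ))), Λ d) * sS u
          ≤ KN * h / u * sS u := mul_le_mul_of_nonneg_right hN (hsS0 u)
        _ = KN * h * (sS u / u) := by ring
  -- integrate
  have hRint : IntegrableOn (fun u => KN * h * (sS u / u)) (Set.Ioc 0 x) := by
    refine Integrable.const_mul ?_ _
    refine Measure.integrableOn_of_bounded (M := 1) measure_Ioc_lt_top.ne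
      (hsSmeas.div measurable_id).aestronglyMeasurable ?_
    refine (ae_restrict_iff' measurableSet_Ioc).2 (Filter.Eventually.of_forall fun u hu => ?_)
    rw [Real.norm_eq_abs, abs_of_nonneg (div_nonneg (hsS0 u) hu.1.le), div_le_one hu.1]
    exact hsSle u hu.1.le
  calc ∫ u in Set.Ioc 0 x, ∑ d ∈ F, Λ d * (Set.Ioc ((x - h) / d) (x / d)).indicator sS u
      ≤ ∫ u in Set.Ioc 0 x, KN * h * (sS u / u) :=
        setIntegral_mono_on (MeasureTheory.integrable_finsetSum _ hinteg) hRint measurableSet_Ioc hpt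
    _ = KN * h * ∫ u in Set.Ioc 0 x, sS u / u := MeasureTheory.integral_const_mul _ _
    _ = KN * h * ∫ w in (0 : ℝ)..L, ‖S₁ f (Real.exp w)‖ := by
        rw [show Set.Ioc 0 x = Set.Ioc 0 (Real.exp L) by rw [hxexp], setIntegral_norm_S₁_div_eq f hL0.le]

/-- **The bound for `T₁(x)`** (Roy–Vatwani 2019, §6.1, (eq:bdT1)–(eq:bound T1), `k = 1`): there is
an absolute `K` such that for every totally multiplicative `f` with `|f| ≤ 1`, every `x ≥ e^{500}` and
every `M ≥ 0` with `|S₁(u)| log u ≤ M` for `1 ≤ u ≤ x`,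
`|Σ_{n ≤ x} f(n) log n/n| ≤ 3 + K ∫_0^{log x} |S₁(e^w)| dw + K (log log x/log x) M`
("`T₁(x) ≪ ∫_1^x |F₁(u)| du/u + |F₁(x)| log log x`", with `|F₁(u)| ≤ M/log u` on `u ≤ x` in place of
the monotonicity hypothesis (eq:condition on x)). [cite: RoyVatwani2019, §6.1 (eq:bound T1)] -/
theorem exists_norm_T₁_le :
    ∃ K : ℝ, 0 < K ∧ ∀ f : ℕ →*₀ ℂ, (∀ n, ‖f n‖ ≤ 1) → ∀ x : ℝ, Real.exp 500 ≤ x →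
      ∀ M : ℝ, 0 ≤ M → (∀ u : ℝ, 1 ≤ u → u ≤ x → ‖S₁ f u‖ * Real.log u ≤ M) →
        ‖∑ n ∈ Finset.Icc 1 ⌊x⌋₊, f n * (Real.log n : ℂ) / n‖ ≤
          3 + K * (∫ w in (0 : ℝ)..Real.log x, ‖S₁ f (Real.exp w)‖) +
            K * (Real.log (Real.log x) / Real.log x) * M := by
  obtain ⟨KN, hKN, hBT⟩ := exists_psi_sub_psi_le
  obtain ⟨K₀, hK₀, hK⟩ := exists_tsum_vonMangoldt_div_rpow_le
  refine ⟨max KN (2 * Real.exp 1 * (5 + K₀)), lt_max_of_lt_left hKN, fun f hf x hx M hM0 hM => ?_⟩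
  have hx0 : 0 < x := (Real.exp_pos _).trans_le hx
  have hx1 : 1 ≤ x := le_trans (by have := Real.add_one_le_exp (500 : ℝ); linarith) hx
  set L : ℝ := Real.log x with hL
  have hL500 : 500 ≤ L := by rw [hL, Real.le_log_iff_exp_le hx0]; exact hx
  have hL0 : 0 < L := by linarith
  set h : ℝ := x / L with hh
  have hh0 : 0 < h := div_pos hx0 hL0
  have hh2 : h ≤ x / 2 := by rw [hh]; exact div_le_div_of_nonneg_left hx0.le two_pos (by linarith)
  have hxh0 : 0 < x - h := by linarith
  set b : ℕ → ℂ := fun n => f n * (Real.log n : ℂ) / n with hb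
  have hTx : ∑ n ∈ Finset.Icc 1 ⌊x⌋₊, f n * (Real.log n : ℂ) / n = psum b x := rfl
  rw [hTx]
  set sS : ℝ → ℝ := fun u => ‖S₁ f u‖ with hsS
  have hsS0 : ∀ u, 0 ≤ sS u := fun u => norm_nonneg _
  have hsSle : ∀ u, 0 ≤ u → sS u ≤ u := fun u hu => norm_S₁_le_self f hf hu
  have hsSmeas : Measurable sS := measurable_norm_S₁ f
  -- (b) averaging over `v ∈ [x − h, x]`
  have hTint : IntervalIntegrable (fun v => ‖psum b v‖) volume (x - h) x := by
    rw [intervalIntegrable_iff_integrableOn_Icc_of_le (by linarith)]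
    refine Measure.integrableOn_of_bounded (M := x * L) measure_Icc_lt_top.ne
      (MellinPlancherel.measurable_psum b).norm.aestronglyMeasurable ?_
    refine (ae_restrict_iff' measurableSet_Icc).2 (Filter.Eventually.of_forall fun v hv => ?_)
    rw [Real.norm_eq_abs, abs_of_nonneg (norm_nonneg _)]
    exact norm_T₁_le_mul_log f hf hx1 hv.2
  have havg : h * (‖psum b x‖ - 3) ≤ ∫ v in (x - h)..x, ‖psum b v‖ := by
    have h1 : ∫ v in (x - h)..x, (‖psum b x‖ - 3) ≤ ∫ v in (x - h)..x, ‖psum b v‖ := by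
      refine intervalIntegral.integral_mono_on (by linarith) intervalIntegrable_const hTint fun v hv => ?_
      have := norm_sub_norm_le (psum b x) (psum b v)
      linarith [norm_T₁_sub_le f hf hx hv]
    rw [intervalIntegral.integral_const, smul_eq_mul, show x - (x - h) = h by ring] at h1
    exact h1
  -- (c)+(d) `∫|T₁(v)| dv ≤ Σ_d (Λ(d)/d) ∫ |S₁(v/d)| dv`
  have hSint : ∀ d ∈ Finset.Icc 1 ⌊x⌋₊, IntervalIntegrable (fun v => sS (v / d)) volume (x - h) x := by
    intro d hd
    rw [Finset.mem_Icc] at hd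
    have hd0 : (0 : ℝ) < d := by exact_mod_cast hd.1
    rw [intervalIntegrable_iff_integrableOn_Icc_of_le (by linarith)]
    refine Measure.integrableOn_of_bounded (M := x) measure_Icc_lt_top.ne
      (hsSmeas.comp (measurable_id.div_const _)).aestronglyMeasurable ?_
    refine (ae_restrict_iff' measurableSet_Icc).2 (Filter.Eventually.of_forall fun v hv => ?_)
    rw [Real.norm_eq_abs, abs_of_nonneg (hsS0 _)]
    have hv0 : 0 ≤ v := hxh0.le.trans hv.1
    exact (hsSle _ (div_nonneg hv0 hd0.le)).trans ((div_le_self hv0 (by exact_mod_cast hd.1)).trans hv.2)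
  have hsumint : IntervalIntegrable (fun v => ∑ d ∈ Finset.Icc 1 ⌊x⌋₊, Λ d / d * sS (v / d)) volume (x - h) x := by
    have := IntervalIntegrable.sum (Finset.Icc 1 ⌊x⌋₊) fun d hd => (hSint d hd).const_mul (Λ d / d)
    have heq : (∑ i ∈ Finset.Icc 1 ⌊x⌋₊, fun v : ℝ => Λ i / i * sS (v / i)) =
        fun v => ∑ d ∈ Finset.Icc 1 ⌊x⌋₊, Λ d / d * sS (v / d) := by
      ext v; simp only [Finset.sum_apply]
    rw [heq] at this
    exact this
  have hint1 : ∫ v in (x - h)..x, ‖psum b v‖ ≤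
      ∑ d ∈ Finset.Icc 1 ⌊x⌋₊, Λ d * ∫ u in (x - h) / d..x / d, sS u := by
    have h1 : ∫ v in (x - h)..x, ‖psum b v‖ ≤ ∫ v in (x - h)..x, ∑ d ∈ Finset.Icc 1 ⌊x⌋₊, Λ d / d * sS (v / d) :=
      intervalIntegral.integral_mono_on (by linarith) hTint hsumint fun v hv => norm_T₁_le_sum f hf hv.2
    refine h1.trans (le_of_eq ?_)
    rw [intervalIntegral.integral_finsetSum fun d hd => (hSint d hd).const_mul _]
    refine Finset.sum_congr rfl fun d hd => ?_
    rw [Finset.mem_Icc] at hd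
    have hd0 : (d : ℝ) ≠ 0 := by exact_mod_cast (show d ≠ 0 by omega)
    rw [intervalIntegral.integral_const_mul, intervalIntegral.integral_comp_div (fun u => sS u) hd0, smul_eq_mul]
    field_simp
  -- (f)+(g) split at `D₀`
  have hsplit : ∑ d ∈ Finset.Icc 1 ⌊x⌋₊, Λ d * ∫ u in (x - h) / d..x / d, sS u =
      (∑ d ∈ (Finset.Icc 1 ⌊x⌋₊).filter (fun d => d ≤ ⌊L ^ 5⌋₊), Λ d * ∫ u in (x - h) / d..x / d, sS u) +
        ∑ d ∈ (Finset.Icc 1 ⌊x⌋₊).filter (fun d => ¬ d ≤ ⌊L ^ 5⌋₊), Λ d * ∫ u in (x - h) / d..x / d, sS u :=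
    (Finset.sum_filter_add_sum_filter_not _ _ _).symm
  have hsmall : ∑ d ∈ (Finset.Icc 1 ⌊x⌋₊).filter (fun d => d ≤ ⌊L ^ 5⌋₊), Λ d * ∫ u in (x - h) / d..x / d, sS u ≤
      2 * M * h / L * (Real.exp 1 * (5 * Real.log L + K₀)) := by
    have hsub : (Finset.Icc 1 ⌊x⌋₊).filter (fun d => d ≤ ⌊L ^ 5⌋₊) ⊆ Finset.Icc 1 ⌊L ^ 5⌋₊ := by
      intro d hd
      simp only [Finset.mem_filter, Finset.mem_Icc] at hd ⊢
      exact ⟨hd.1.1, hd.2⟩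
    refine (Finset.sum_le_sum_of_subset_of_nonneg hsub fun d hd _ => ?_).trans (sum_small_le hK f hx hM0 hM)
    rw [Finset.mem_Icc] at hd
    have hd0 : (0 : ℝ) < d := by exact_mod_cast hd.1
    exact mul_nonneg ArithmeticFunction.vonMangoldt_nonneg
      (intervalIntegral.integral_nonneg (div_le_div_of_nonneg_right (by linarith) hd0.le) fun u _ => hsS0 u)
  have hlarge := sum_large_le hKN hBT f hf hx
  -- assemble
  set I : ℝ := ∫ w in (0 : ℝ)..L, ‖S₁ f (Real.exp w)‖ with hI
  have hI0 : 0 ≤ I := intervalIntegral.integral_nonneg hL0.le fun w _ => norm_nonneg _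
  have hmain : h * (‖psum b x‖ - 3) ≤ 2 * M * h / L * (Real.exp 1 * (5 * Real.log L + K₀)) + KN * h * I := by
    calc h * (‖psum b x‖ - 3) ≤ ∫ v in (x - h)..x, ‖psum b v‖ := havg
      _ ≤ _ := hint1
      _ = _ := hsplit
      _ ≤ _ := add_le_add hsmall hlarge
  have hdiv : ‖psum b x‖ - 3 ≤ 2 * M / L * (Real.exp 1 * (5 * Real.log L + K₀)) + KN * I := by
    have h2 : h * (‖psum b x‖ - 3) ≤ h * (2 * M / L * (Real.exp 1 * (5 * Real.log L + K₀)) + KN * I) := by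
      refine hmain.trans (le_of_eq ?_); ring
    exact le_of_mul_le_mul_left h2 hh0
  have hK1 : KN ≤ max KN (2 * Real.exp 1 * (5 + K₀)) := le_max_left _ _
  have hK2 : 2 * Real.exp 1 * (5 + K₀) ≤ max KN (2 * Real.exp 1 * (5 + K₀)) := le_max_right _ _
  have hlogL1 : 1 ≤ Real.log L := by
    rw [Real.le_log_iff_exp_le hL0]; have := Real.exp_one_lt_d9; linarith
  have hcoef : 2 * M / L * (Real.exp 1 * (5 * Real.log L + K₀)) ≤
      max KN (2 * Real.exp 1 * (5 + K₀)) * (Real.log L / L) * M := by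
    have h1 : 5 * Real.log L + K₀ ≤ (5 + K₀) * Real.log L := by nlinarith
    calc 2 * M / L * (Real.exp 1 * (5 * Real.log L + K₀))
        ≤ 2 * M / L * (Real.exp 1 * ((5 + K₀) * Real.log L)) := by gcongr
      _ = (2 * Real.exp 1 * (5 + K₀)) * (Real.log L / L) * M := by field_simp
      _ ≤ max KN (2 * Real.exp 1 * (5 + K₀)) * (Real.log L / L) * M := by gcongr
  have hKI : KN * I ≤ max KN (2 * Real.exp 1 * (5 + K₀)) * I := mul_le_mul_of_nonneg_right hK1 hI0
  linarith [hdiv, hcoef, hKI]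

end Literature.NumberTheory.LFunctions.MontgomeryVaughan2001
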